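import Mathlib
import HarnessLib.Audit
import Summits.PneNP.PneNP.Theorems.PstarChordBridgeExchange

/-!
# Forest-edge minimality in the coordinates of the original core (ROUND-24, memo §11 (N2); companion of `PstarChordBridgeExchange`)

FRONTIER range-avoidance ladder, rung F-N3, ROUND 24 (cell `pnp-ideate`, planner memo `r24/CORE-BOUND-NOTES.md` §11 (N2), §4–§5; restricted-model proof
complexity — nothing here bears on `P` versus `NP`).

`PstarChordBridgeExchange` turns minimality in a forest edge `j ∈ D e₁` into feasibility of the EXCHANGED chord system.  This file translates that
back into the coordinates of the ORIGINAL bridge data `B`, in the regime where no pendant reads the privates `p₁, q₁` of the promoted chord `e₁`: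

* `privs_erase` — the privates of `N − e₁` are the privates of `N` minus `{p₁, q₁}`;
* `free_exchange` — the state-free parts of the exchanged system: `free'ᵢ = freeᵢ + [j ∈ Tᵢ]·(u_{e₁} + x_{p₁}x_{q₁}) + [p₁ ∈ Cᵢ]·x_{p₁} + [q₁ ∈ Cᵢ]·x_{q₁}`;
* `forest_minimality` — **the defect form of (M0) at a forest edge**: a solution `z` of `(J₀ − j) ∧ Γ₁ ∧ Γ₂`, read as base point `x = bit ∘ z` with
  states `s_e = (z_{p_e}, z_{q_e})` and DEFECT `δ := u_{e₁}(x) + x_{p₁} x_{q₁}` (`= 1` iff the promoted chord's cycle equation fails, i.e. iff `j`'s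
  output is violated), satisfies `p_e q_e = u_e(x) + [j ∈ D e]·δ` for every chord `e ≠ e₁` and `val N x s = t + (δ[j ∈ T₁], δ[j ∈ T₂])`;
* `defect_eq_one` — and `δ = 1` as soon as the whole system is unsolvable (T3): **deleting a forest edge flips exactly the prescriptions of the
  chords whose fundamental set contains it and the constraints whose join contains it, and nothing else.**
-/

set_option linter.dupNamespace false -- `Summit.PneNP.PneNP.…`: summit = sub-problem name (D-0017 single-conjunct layout)

open Finset Literature.Computability.Complexity
open scoped symmDiff
open Summit.PneNP.PneNP.Theorems.PstarFibrePolys (bit bit_xor bit_and bit_injective)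
open Summit.PneNP.PneNP.Theorems.PstarPDT (parity bit_eval)
open Summit.PneNP.PneNP.Theorems.PstarTyped (Typed)
open Summit.PneNP.PneNP.Theorems.PstarSALevel (varSet bdry)
open Summit.PneNP.PneNP.Theorems.PstarGapOneAll (gval)
open Summit.PneNP.PneNP.Theorems.PstarXorElimination (pdeg)
open Summit.PneNP.PneNP.Theorems.PstarXCore (xpair xverts mem_xpair)
open Summit.PneNP.PneNP.Theorems.PstarChordRepair (IsChord)
open Summit.PneNP.PneNP.Theorems.PstarGraphQuadGapTwoForms (sum_symmDiff_zmod2)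
open Summit.PneNP.PneNP.Theorems.PstarReadSumset (V2)
open Summit.PneNP.PneNP.Theorems.PstarChordSystem (ChordSystem)
open Summit.PneNP.PneNP.Theorems.PstarChordBridgeTools
open Summit.PneNP.PneNP.Theorems.PstarChordBridge
open Summit.PneNP.PneNP.Theorems.PstarChordBridgeForcing (coef_of_unread)
open Summit.PneNP.PneNP.Theorems.PstarChordBridgeExchange

namespace Summit.PneNP.PneNP.Theorems.PstarChordBridgeForest

variable {n m : ℕ}

/-- **Privates of `N − e₁`** are the privates of `N` without those of `e₁`. -/
theorem privs_erase (I : LocalMap 4 n m) {J₀ N : Finset (Fin m)} (hN : N ⊆ J₀) (hch : ∀ e ∈ N, IsChord I J₀ e) {e₁ : Fin m} (he₁ : e₁ ∈ N)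
    (v : Fin n) : v ∈ privs I (N.erase e₁) ↔ v ∈ privs I N ∧ v ≠ I.vars e₁ 2 ∧ v ≠ I.vars e₁ 3 := by
  rw [mem_privs, mem_privs]
  constructor
  · rintro ⟨e, he, hv⟩
    have he' := mem_erase.1 he
    refine ⟨⟨e, he'.2, hv⟩, ?_, ?_⟩
    · rintro rfl
      rcases hv with h | h
      · exact he'.1 (chord_eq_of_vars_eq I hN hch he₁ (hN he'.2) (s := 2) (s' := 2) (by decide) h.symm)
      · exact he'.1 (chord_eq_of_vars_eq I hN hch he₁ (hN he'.2) (s := 2) (s' := 3) (by decide) h.symm)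
    · rintro rfl
      rcases hv with h | h
      · exact he'.1 (chord_eq_of_vars_eq I hN hch he₁ (hN he'.2) (s := 3) (s' := 2) (by decide) h.symm)
      · exact he'.1 (chord_eq_of_vars_eq I hN hch he₁ (hN he'.2) (s := 3) (s' := 3) (by decide) h.symm)
  · rintro ⟨⟨e, he, hv⟩, h2, h3⟩
    refine ⟨e, mem_erase.2 ⟨?_, he⟩, hv⟩
    rintro rfl
    rcases hv with h | h
    · exact h2 h.symm
    · exact h3 h.symm

/-- **The state-free parts after the exchange** (no pendant of `G` reads a private of `e₁`). -/
theorem free_exchange (I : LocalMap 4 n m) (hI : I.IsPure xorAndPred) (hT : Typed I) {B : BridgeData n m} (hW : B.WF I) {j e₁ : Fin m}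
    (he₁ : e₁ ∈ B.N) (hj : j ∈ B.D e₁) {T : Finset (Fin m)} (C : Finset (Fin n)) {G : Finset (Fin m)}
    (hG : ∀ g ∈ G, I.vars g 2 ≠ I.vars e₁ 2 ∧ I.vars g 2 ≠ I.vars e₁ 3 ∧ I.vars g 3 ≠ I.vars e₁ 2 ∧ I.vars g 3 ≠ I.vars e₁ 3)
    (x : Fin n → ZMod 2) :
    free I B.y ((exchange B j e₁).J₀ \ (exchange B j e₁).N) (B.N.erase e₁) (if j ∈ T then T ∆ insert e₁ (B.D e₁) else T) C G x =
      free I B.y (B.J₀ \ B.N) B.N T C G x + (if j ∈ T then (sys I B).u e₁ x + x (I.vars e₁ 2) * x (I.vars e₁ 3) else 0)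
        + (if I.vars e₁ 2 ∈ C then x (I.vars e₁ 2) else 0) + (if I.vars e₁ 3 ∈ C then x (I.vars e₁ 3) else 0) := by
  classical
  have he₁D : e₁ ∉ B.D e₁ := fun h => (mem_sdiff.1 (hW.hD e₁ he₁ h)).2 he₁
  have h23 : I.vars e₁ 2 ≠ I.vars e₁ 3 := fun h => absurd (hI.2 e₁ h) (by decide)
  have hxv := xverts_exchange I hI hW he₁ hj
  unfold free
  rw [hxv]
  -- (i) the linear part: the two privates of `e₁` join the ordinary linear reads
  have hlin : ∑ v ∈ C.filter (fun v => v ∉ xverts I (B.J₀ \ B.N) ∧ v ∉ privs I (B.N.erase e₁)), x v =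
      ∑ v ∈ C.filter (fun v => v ∉ xverts I (B.J₀ \ B.N) ∧ v ∉ privs I B.N), x v
        + ((if I.vars e₁ 2 ∈ C then x (I.vars e₁ 2) else 0) + (if I.vars e₁ 3 ∈ C then x (I.vars e₁ 3) else 0)) := by
    have hsplit : C.filter (fun v => v ∉ xverts I (B.J₀ \ B.N) ∧ v ∉ privs I (B.N.erase e₁)) =
        C.filter (fun v => v ∉ xverts I (B.J₀ \ B.N) ∧ v ∉ privs I B.N) ∪ C.filter (fun v => v = I.vars e₁ 2 ∨ v = I.vars e₁ 3) := by
      ext v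
      simp only [mem_filter, mem_union, privs_erase I hW.hN hW.hchord he₁, not_and_or, not_not]
      constructor
      · rintro ⟨hvC, hvx, hvp⟩
        rcases hvp with hvp | hvp | hvp
        · exact Or.inl ⟨hvC, hvx, hvp⟩
        · exact Or.inr ⟨hvC, Or.inl hvp⟩
        · exact Or.inr ⟨hvC, Or.inr hvp⟩
      · rintro (⟨hvC, hvx, hvp⟩ | ⟨hvC, hvp⟩)
        · exact ⟨hvC, hvx, Or.inl hvp⟩
        · rcases hvp with rfl | rfl
          · exact ⟨hvC, not_mem_xverts_of_two_le I hT _ e₁ (s := 2) (by decide), Or.inr (Or.inl rfl)⟩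
          · exact ⟨hvC, not_mem_xverts_of_two_le I hT _ e₁ (s := 3) (by decide), Or.inr (Or.inr rfl)⟩
    have hdisj : Disjoint (C.filter (fun v => v ∉ xverts I (B.J₀ \ B.N) ∧ v ∉ privs I B.N))
        (C.filter (fun v => v = I.vars e₁ 2 ∨ v = I.vars e₁ 3)) := by
      rw [disjoint_left]
      intro v hv hv'
      rcases (mem_filter.1 hv').2 with rfl | rfl
      · exact (mem_filter.1 hv).2.2 (vars_mem_privs I he₁ (s := 2) (by decide))
      · exact (mem_filter.1 hv).2.2 (vars_mem_privs I he₁ (s := 3) (by decide))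
    rw [hsplit, sum_union hdisj]
    congr 1
    -- the sum over `C ∩ {p₁, q₁}`
    have hpair : C.filter (fun v => v = I.vars e₁ 2 ∨ v = I.vars e₁ 3) =
        (if I.vars e₁ 2 ∈ C then {I.vars e₁ 2} else ∅) ∪ (if I.vars e₁ 3 ∈ C then {I.vars e₁ 3} else ∅) := by
      ext v
      simp only [mem_filter, mem_union]
      constructor
      · rintro ⟨hvC, rfl | rfl⟩
        · left; rw [if_pos hvC]; exact mem_singleton_self _
        · right; rw [if_pos hvC]; exact mem_singleton_self _
      · rintro (h | h)
        · split_ifs at h with hc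
          · rw [mem_singleton] at h; exact ⟨h ▸ hc, Or.inl h⟩
          · exact absurd h (notMem_empty v)
        · split_ifs at h with hc
          · rw [mem_singleton] at h; exact ⟨h ▸ hc, Or.inr h⟩
          · exact absurd h (notMem_empty v)
    rw [hpair, sum_union]
    · congr 1
      · split_ifs <;> simp
      · split_ifs <;> simp
    · rw [disjoint_left]
      intro v hv hv'
      split_ifs at hv hv' <;> simp_all
  -- (ii) the join part
  have hjoin : ∑ k ∈ (if j ∈ T then T ∆ insert e₁ (B.D e₁) else T), (bit (B.y k) + x (I.vars k 2) * x (I.vars k 3)) =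
      ∑ k ∈ T, (bit (B.y k) + x (I.vars k 2) * x (I.vars k 3))
        + (if j ∈ T then (sys I B).u e₁ x + x (I.vars e₁ 2) * x (I.vars e₁ 3) else 0) := by
    split_ifs with hjT
    · rw [sum_symmDiff_zmod2, sum_insert_eq_uval I B.y he₁D, sys_u]
    · rw [add_zero]
  -- (iii) the monomial part is unchanged
  have hmon : G.filter (fun g => ¬ (I.vars g 2 ∈ privs I (B.N.erase e₁) ∨ I.vars g 3 ∈ privs I (B.N.erase e₁))) =
      G.filter (fun g => ¬ (I.vars g 2 ∈ privs I B.N ∨ I.vars g 3 ∈ privs I B.N)) := by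
    refine filter_congr fun g hg => ?_
    obtain ⟨h22, h23', h32, h33⟩ := hG g hg
    rw [privs_erase I hW.hN hW.hchord he₁, privs_erase I hW.hN hW.hchord he₁]
    tauto
  rw [hlin, hjoin, hmon]
  ring

/-- **(M0) at a forest edge, defect form.**  `B` well formed, `e₁ ∈ N` a chord, `j ∈ D e₁` a forest edge, no pendant reading the privates of `e₁`;
`z` a solution of `(J₀ − j) ∧ Γ₁ ∧ Γ₂`.  With `x = bit ∘ z`, `s_e = (z_{p_e}, z_{q_e})` and `δ = u_{e₁}(x) + x_{p₁}x_{q₁}`: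
every other chord has `p_e q_e = u_e(x) + [j ∈ D e]·δ`, and `val N x s = t + (δ[j ∈ T₁], δ[j ∈ T₂])`. -/
theorem forest_minimality (I : LocalMap 4 n m) (hI : I.IsPure xorAndPred) (hT : Typed I) {B : BridgeData n m} (hW : B.WF I) {j e₁ : Fin m}
    (he₁ : e₁ ∈ B.N) (hj : j ∈ B.D e₁)
    (hG₁ : ∀ g ∈ B.G₁, I.vars g 2 ≠ I.vars e₁ 2 ∧ I.vars g 2 ≠ I.vars e₁ 3 ∧ I.vars g 3 ≠ I.vars e₁ 2 ∧ I.vars g 3 ≠ I.vars e₁ 3)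
    (hG₂ : ∀ g ∈ B.G₂, I.vars g 2 ≠ I.vars e₁ 2 ∧ I.vars g 2 ≠ I.vars e₁ 3 ∧ I.vars g 3 ≠ I.vars e₁ 2 ∧ I.vars g 3 ≠ I.vars e₁ 3)
    {z : Fin n → Bool} (hz : Solution I B (B.J₀.erase j) z) :
    (∀ e ∈ B.N, e ≠ e₁ → bit (z (I.vars e 2)) * bit (z (I.vars e 3)) =
        (sys I B).u e (fun v => bit (z v)) +
          (if j ∈ B.D e then (sys I B).u e₁ (fun v => bit (z v)) + bit (z (I.vars e₁ 2)) * bit (z (I.vars e₁ 3)) else 0)) ∧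
    (sys I B).val B.N (fun v => bit (z v)) (fun e => (bit (z (I.vars e 2)), bit (z (I.vars e 3)))) =
      (sys I B).t +
        ((if j ∈ B.T₁ then (sys I B).u e₁ (fun v => bit (z v)) + bit (z (I.vars e₁ 2)) * bit (z (I.vars e₁ 3)) else 0),
         (if j ∈ B.T₂ then (sys I B).u e₁ (fun v => bit (z v)) + bit (z (I.vars e₁ 2)) * bit (z (I.vars e₁ 3)) else 0)) := by
  classical
  set B' := exchange B j e₁ with hB'
  have hW' : B'.WF I := exchange_wf I hI hW he₁ hj
  have hjN : j ∉ B.N := (mem_sdiff.1 (hW.hD e₁ he₁ hj)).2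
  -- `z` solves the forest of the exchanged data
  have hzF : ∀ k ∈ B'.J₀ \ B'.N, I.eval z k = B'.y k := fun k hk => hz.1 k (mem_sdiff.1 hk).1
  refine ⟨fun e he hne => ?_, ?_⟩
  · -- chords: admissibility in `B'`, translated by `sys_exchange_u`
    have heN' : e ∈ B'.N := mem_erase.2 ⟨hne, he⟩
    have heJ : e ∈ B.J₀.erase j := mem_erase.2 ⟨fun h => hjN (h ▸ he), hW.hN he⟩
    have hadm := (eval_iff_adm I hI hW' hzF heN').1 (hz.1 e heJ)
    rw [hadm, hB', sys_exchange_u I hW he₁]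
  · -- constraints: `val' = (gval₁, gval₂) = t`, and `val'` differs from `val` by the corrections of `free_exchange`
    set x : Fin n → ZMod 2 := fun v => bit (z v) with hx
    have hF₁ := free_exchange I hI hT hW he₁ hj (T := B.T₁) B.C₁ hG₁ x
    have hF₂ := free_exchange I hI hT hW he₁ hj (T := B.T₂) B.C₂ hG₂ x
    -- the exchanged system's value, in closed form, equals the target
    have h := val_of_solution I hI hT hW' hzF
    rw [val_sys] at h
    have h' : ((free I B.y ((exchange B j e₁).J₀ \ (exchange B j e₁).N) (B.N.erase e₁) (if j ∈ B.T₁ then B.T₁ ∆ insert e₁ (B.D e₁) else B.T₁) B.C₁ B.G₁ x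
          + ∑ e ∈ B.N.erase e₁, ((bit (z (I.vars e 2)), bit (z (I.vars e 3))).1 * coef I B.C₁ B.G₁ (I.vars e 2) x
              + (bit (z (I.vars e 2)), bit (z (I.vars e 3))).2 * coef I B.C₁ B.G₁ (I.vars e 3) x),
        free I B.y ((exchange B j e₁).J₀ \ (exchange B j e₁).N) (B.N.erase e₁) (if j ∈ B.T₂ then B.T₂ ∆ insert e₁ (B.D e₁) else B.T₂) B.C₂ B.G₂ x
          + ∑ e ∈ B.N.erase e₁, ((bit (z (I.vars e 2)), bit (z (I.vars e 3))).1 * coef I B.C₂ B.G₂ (I.vars e 2) x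
              + (bit (z (I.vars e 2)), bit (z (I.vars e 3))).2 * coef I B.C₂ B.G₂ (I.vars e 3) x)) : V2) =
        (bit (gval I B.C₁ B.G₁ z), bit (gval I B.C₂ B.G₂ z)) := h
    rw [hz.2.1, hz.2.2, hF₁, hF₂] at h'
    have h1 := congrArg Prod.fst h'
    have h2 := congrArg Prod.snd h'
    simp only at h1 h2
    -- the read coefficients of the privates of `e₁` are the linear indicators
    have hc2 : ∀ (C : Finset (Fin n)) (G : Finset (Fin m)),
        (∀ g ∈ G, I.vars g 2 ≠ I.vars e₁ 2 ∧ I.vars g 2 ≠ I.vars e₁ 3 ∧ I.vars g 3 ≠ I.vars e₁ 2 ∧ I.vars g 3 ≠ I.vars e₁ 3) →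
        coef I C G (I.vars e₁ 2) x = (if I.vars e₁ 2 ∈ C then 1 else 0) ∧ coef I C G (I.vars e₁ 3) x = (if I.vars e₁ 3 ∈ C then 1 else 0) :=
      fun C G hG => ⟨coef_of_unread I (fun g hg => ⟨(hG g hg).1, (hG g hg).2.2.1⟩) _, coef_of_unread I (fun g hg => ⟨(hG g hg).2.1, (hG g hg).2.2.2⟩) _⟩
    -- split the sum over `N` at `e₁`
    have hsum : ∀ (C : Finset (Fin n)) (G : Finset (Fin m)),
        ∑ e ∈ B.N, ((bit (z (I.vars e 2)), bit (z (I.vars e 3))).1 * coef I C G (I.vars e 2) x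
            + (bit (z (I.vars e 2)), bit (z (I.vars e 3))).2 * coef I C G (I.vars e 3) x) =
        ((bit (z (I.vars e₁ 2)), bit (z (I.vars e₁ 3))).1 * coef I C G (I.vars e₁ 2) x
            + (bit (z (I.vars e₁ 2)), bit (z (I.vars e₁ 3))).2 * coef I C G (I.vars e₁ 3) x) +
        ∑ e ∈ B.N.erase e₁, ((bit (z (I.vars e 2)), bit (z (I.vars e 3))).1 * coef I C G (I.vars e 2) x
            + (bit (z (I.vars e 2)), bit (z (I.vars e 3))).2 * coef I C G (I.vars e 3) x) :=
      fun C G => (add_sum_erase B.N _ he₁).symm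
    rw [val_sys, sys_t, hsum B.C₁ B.G₁, hsum B.C₂ B.G₂, (hc2 B.C₁ B.G₁ hG₁).1, (hc2 B.C₁ B.G₁ hG₁).2, (hc2 B.C₂ B.G₂ hG₂).1,
      (hc2 B.C₂ B.G₂ hG₂).2]
    have hxp : x (I.vars e₁ 2) = bit (z (I.vars e₁ 2)) := rfl
    have hxq : x (I.vars e₁ 3) = bit (z (I.vars e₁ 3)) := rfl
    rw [hxp, hxq] at h1 h2
    refine Prod.ext ?_ ?_
    · simp only [Prod.fst_add, mul_ite, mul_one, mul_zero] at h1 ⊢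
      have hj2 : (if j ∈ B.T₁ then (sys I B).u e₁ x + bit (z (I.vars e₁ 2)) * bit (z (I.vars e₁ 3)) else 0)
          + (if j ∈ B.T₁ then (sys I B).u e₁ x + bit (z (I.vars e₁ 2)) * bit (z (I.vars e₁ 3)) else 0) = 0 := by
        generalize (if j ∈ B.T₁ then (sys I B).u e₁ x + bit (z (I.vars e₁ 2)) * bit (z (I.vars e₁ 3)) else 0) = t
        revert t; decide
      linear_combination h1 - hj2
    · simp only [Prod.snd_add, mul_ite, mul_one, mul_zero] at h2 ⊢
      have hj2 : (if j ∈ B.T₂ then (sys I B).u e₁ x + bit (z (I.vars e₁ 2)) * bit (z (I.vars e₁ 3)) else 0)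
          + (if j ∈ B.T₂ then (sys I B).u e₁ x + bit (z (I.vars e₁ 2)) * bit (z (I.vars e₁ 3)) else 0) = 0 := by
        generalize (if j ∈ B.T₂ then (sys I B).u e₁ x + bit (z (I.vars e₁ 2)) * bit (z (I.vars e₁ 3)) else 0) = t
        revert t; decide
      linear_combination h2 - hj2

/-- **The defect is `1`**: if the whole terminal system is unsolvable, a solution of `(J₀ − j) ∧ Γ₁ ∧ Γ₂` violates the cycle of the promoted chord. -/
theorem defect_eq_one (I : LocalMap 4 n m) (hI : I.IsPure xorAndPred) {B : BridgeData n m} (hW : B.WF I) {j e₁ : Fin m}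
    (he₁ : e₁ ∈ B.N) (hj : j ∈ B.D e₁) (hT3 : ¬ ∃ z, Solution I B B.J₀ z) {z : Fin n → Bool} (hz : Solution I B (B.J₀.erase j) z) :
    (sys I B).u e₁ (fun v => bit (z v)) + bit (z (I.vars e₁ 2)) * bit (z (I.vars e₁ 3)) = 1 := by
  classical
  -- otherwise `j`'s own output would hold at `z`
  have hjF : j ∈ B.J₀ \ B.N := hW.hD e₁ he₁ hj
  have he₁D : e₁ ∉ B.D e₁ := fun h => (mem_sdiff.1 (hW.hD e₁ he₁ h)).2 he₁
  by_contra hδ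
  have hδ0 : (sys I B).u e₁ (fun v => bit (z v)) + bit (z (I.vars e₁ 2)) * bit (z (I.vars e₁ 3)) = 0 := by
    generalize (sys I B).u e₁ (fun v => bit (z v)) + bit (z (I.vars e₁ 2)) * bit (z (I.vars e₁ 3)) = t at hδ ⊢
    revert t; decide
  apply hT3
  refine ⟨z, fun k hk => ?_, hz.2.1, hz.2.2⟩
  by_cases hkj : k = j
  swap
  · exact hz.1 k (mem_erase.2 ⟨hkj, hk⟩)
  subst hkj
  -- the cycle `D e₁ + e₁` minus `k`: all its other outputs hold at `z`, and `e₁` holds; so `k` holds (cycle parity)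
  have hcyc : ∀ k' ∈ insert e₁ (B.D e₁), k' ≠ k → I.eval z k' = B.y k' := by
    intro k' hk' hne
    rcases mem_insert.1 hk' with rfl | hk'D
    · exact hz.1 k' (mem_erase.2 ⟨hne, hW.hN he₁⟩)
    · exact hz.1 k' (mem_erase.2 ⟨hne, (mem_sdiff.1 (hW.hD e₁ he₁ hk'D)).1⟩)
  -- evenness of `D e₁ + e₁` at `z` read in `𝔽₂`: the pair sum over the cycle vanishes
  have hsum := sum_pair_eq_zero_of_even (hW.hDeven e₁ he₁) (fun v => bit (z v))
  have hkC : k ∈ insert e₁ (B.D e₁) := mem_insert_of_mem hj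
  rw [← add_sum_erase _ _ hkC] at hsum
  have hrest : ∑ k' ∈ (insert e₁ (B.D e₁)).erase k, (bit (z (I.vars k' 0)) + bit (z (I.vars k' 1))) =
      ∑ k' ∈ (insert e₁ (B.D e₁)).erase k, (bit (B.y k') + bit (z (I.vars k' 2)) * bit (z (I.vars k' 3))) :=
    sum_congr rfl fun k' hk' => pair_eq_of_eval I hI (hcyc k' (mem_of_mem_erase hk') (ne_of_mem_erase hk'))
  rw [hrest] at hsum
  -- compare with the defect: `u_{e₁} + m_{e₁} = Σ_{cycle} (y + m) = 0`, so the `k`-term equals `x_{u_k} + x_{v_k}`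
  have hδ' : ∑ k' ∈ insert e₁ (B.D e₁), (bit (B.y k') + bit (z (I.vars k' 2)) * bit (z (I.vars k' 3))) = 0 := by
    have h := sum_insert_eq_uval I B.y he₁D (fun v => bit (z v))
    rw [h, ← sys_u]; exact hδ0
  rw [← add_sum_erase _ _ hkC] at hδ'
  apply bit_injective
  rw [bit_eval hI]
  have key : ∀ a b yk mk r : ZMod 2, a + b + r = 0 → yk + mk + r = 0 → a + b + mk = yk := by decide
  exact key _ _ _ _ _ hsum hδ'

end Summit.PneNP.PneNP.Theorems.PstarChordBridgeForest
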